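import Literature.Probability.RandomPlanarGeometry.SAWCountMonotoneCutDoublingEscape
import Literature.Probability.RandomPlanarGeometry.SAWCountMonotoneCutFreeBox
import HarnessLib

/-!
# Monotonicity `cₙ ≤ cₙ₊₁` (O'Brien 1990) on the square lattice for every `n ≤ 12`:
# the length `n = 11` by corner forcing

Sequel of `SAWCountMonotoneCutFreeBox.lean` (no cut-free walk on `ℤ²` of length `1 ≤ n ≤ 10` or
`12`, hence `cₙ ≤ cₙ₊₁` there, `count_two_le_count_succ_of_cutFree`) and
`SAWCountMonotoneCutDoublingEscape.lean` (`cₙ ≤ cₙ₊₁ + #(escapeResidual d n ∩ cutFree d n)`) for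
the door `cₙ ≤ cₙ₊₁` (O'Brien, *Monotonicity of the number of self-avoiding walks*, J. Stat.
Phys. **59** (1990) 969–979, quoted in BDGS 2012 §1.3 and Madras–Slade §7.1 p. 231).  The
remaining short length on `ℤ²` is `n = 11 = 6d - 1`, the first odd length at which the escape
residual `R` is non-empty (`escapeResidual_nonempty_iff`); there ARE `32` cut-free `11`-step walks
(certain Hamiltonian paths of a `3 × 4` box — exhaustive enumeration, not used), but none of them
lies in `R`:

* `escapeResidual_inter_cutFree_two_eq_empty` : **`escapeResidual 2 11 ∩ cutFree 2 11 = ∅`.**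
  By the crossing and box bounds a cut-free `11`-step walk fills a `3 × 4` box (all `12` cells
  visited); a completely surrounded start is an interior cell (`exists_eq_of_extCount_revWalk_eq_zero`);
  an end on the boundary of the box escapes along a straight ray (`endFree_of_extreme`), so a
  doomed end is the other interior cell; and **corner forcing** (`column_segment`: a corner of the
  box has only two neighbours in it, so each short column is traversed in one go,
  `(0, s), (-1, s), (-1, 0), (-1, -s), (0, -s)`) determines the walk completely
  (`no_cutFree_hamiltonian_box`): it leaves the start vertically, sweeps the near column, crosses
  to the far column at step `5` and sweeps it — and the hyperplane between the two middle columns is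
  then crossed exactly once, a strict cut edge, contradiction;
* `count_two_eleven_le` : **`c₁₁ ≤ c₁₂` on `ℤ²`**, and with the earlier lengths
  `count_two_le_count_succ_of_le_twelve` : **`cₙ ≤ cₙ₊₁` on `ℤ²` for every `n ≤ 12`.**

The combinatorial core is phrased in coordinates (`x y : ℕ → ℤ`), the second orientation of the
box and the second position of the origin being reduced to the first by swapping the coordinates
and by the central reflection `ω ↦ -ω`.  (The statement with a symbolic `n = 11` avoids kernel
evaluation of `saws 2 11`.)  No named facts are introduced.
[cite: MadrasSlade1993, §1.1; §7.1 p. 231] [cite: BDGS2012, §1.3 (`cₙ ≤ cₙ₊₁`, O'Brien 1990)]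
-/

noncomputable section

open Literature.Probability.LatticeModels Literature.Probability.Percolation SimpleGraph

namespace Literature.Probability.RandomPlanarGeometry.SAW.Zd

/-! ### The combinatorial core in coordinates: Hamiltonian paths of the `3 × 4` box -/

/-- **Corner forcing.** For a nearest-neighbour Hamiltonian path `(x i, y i)_{i ≤ 11}` of the box
`[-1, 2] × [-1, 1]` whose endpoints avoid the column `x = -1`, the column `x = -1` is traversed in
one go: five consecutive times `a, …, a + 4` at the cells `(0, s), (-1, s), (-1, 0), (-1, -s), (0, -s)`
(`s = ±1`) — each corner has only two neighbours in the box. [cite: MadrasSlade1993, §7.1] -/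
private theorem column_segment (x y : ℕ → ℤ)
    (hbx : ∀ i ≤ 11, -1 ≤ x i ∧ x i ≤ 2 ∧ -1 ≤ y i ∧ y i ≤ 1)
    (hadj : ∀ i < 11, (x (i + 1) = x i + 1 ∧ y (i + 1) = y i) ∨ (x (i + 1) = x i - 1 ∧ y (i + 1) = y i) ∨
      (x (i + 1) = x i ∧ y (i + 1) = y i + 1) ∨ (x (i + 1) = x i ∧ y (i + 1) = y i - 1))
    (hinj : ∀ i j, i ≤ 11 → j ≤ 11 → x i = x j → y i = y j → i = j)
    (hvis : ∀ a b : ℤ, -1 ≤ a → a ≤ 2 → -1 ≤ b → b ≤ 1 → ∃ i ≤ 11, x i = a ∧ y i = b)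
    (hx0 : x 0 ≠ -1) (hx11 : x 11 ≠ -1) :
    ∃ a : ℕ, ∃ s : ℤ, (s = 1 ∨ s = -1) ∧ a + 4 ≤ 11 ∧ x a = 0 ∧ y a = s ∧ x (a + 1) = -1 ∧
      y (a + 1) = s ∧ x (a + 2) = -1 ∧ y (a + 2) = 0 ∧ x (a + 3) = -1 ∧ y (a + 3) = -s ∧
      x (a + 4) = 0 ∧ y (a + 4) = -s := by
  -- the corner `(-1, 1)` at time `tC`; its walk-neighbours are `(0, 1)` and `(-1, 0)`
  obtain ⟨tC, htC, hxC, hyC⟩ := hvis (-1) 1 (by norm_num) (by norm_num) (by norm_num) (by norm_num)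
  have htC0 : tC ≠ 0 := by rintro rfl; exact hx0 hxC
  have htC11 : tC ≠ 11 := by rintro rfl; exact hx11 hxC
  have hA := hadj (tC - 1) (by omega)
  rw [show tC - 1 + 1 = tC by omega] at hA
  have hB := hadj tC (by omega)
  have bP := hbx (tC - 1) (by omega)
  have bQ := hbx (tC + 1) (by omega)
  have hPQ : ¬ (x (tC - 1) = x (tC + 1) ∧ y (tC - 1) = y (tC + 1)) := fun h => by
    have := hinj _ _ (by omega) (by omega) h.1 h.2; omega
  have c1 : (x (tC - 1) = 0 ∧ y (tC - 1) = 1 ∧ x (tC + 1) = -1 ∧ y (tC + 1) = 0) ∨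
      (x (tC - 1) = -1 ∧ y (tC - 1) = 0 ∧ x (tC + 1) = 0 ∧ y (tC + 1) = 1) := by omega
  -- the corner `(-1, -1)` at time `tD`; its walk-neighbours are `(0, -1)` and `(-1, 0)`
  obtain ⟨tD, htD, hxD, hyD⟩ :=
    hvis (-1) (-1) (by norm_num) (by norm_num) (by norm_num) (by norm_num)
  have htD0 : tD ≠ 0 := by rintro rfl; exact hx0 hxD
  have htD11 : tD ≠ 11 := by rintro rfl; exact hx11 hxD
  have hA' := hadj (tD - 1) (by omega)
  rw [show tD - 1 + 1 = tD by omega] at hA'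
  have hB' := hadj tD (by omega)
  have bP' := hbx (tD - 1) (by omega)
  have bQ' := hbx (tD + 1) (by omega)
  have hPQ' : ¬ (x (tD - 1) = x (tD + 1) ∧ y (tD - 1) = y (tD + 1)) := fun h => by
    have := hinj _ _ (by omega) (by omega) h.1 h.2; omega
  have c2 : (x (tD - 1) = 0 ∧ y (tD - 1) = -1 ∧ x (tD + 1) = -1 ∧ y (tD + 1) = 0) ∨
      (x (tD - 1) = -1 ∧ y (tD - 1) = 0 ∧ x (tD + 1) = 0 ∧ y (tD + 1) = -1) := by omega
  -- the cell `(-1, 0)` is visited only once: identify the two times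
  rcases c1 with ⟨h1, h2, h3, h4⟩ | ⟨h1, h2, h3, h4⟩ <;>
    rcases c2 with ⟨g1, g2, g3, g4⟩ | ⟨g1, g2, g3, g4⟩
  · have := hinj (tC + 1) (tD + 1) (by omega) (by omega) (by omega) (by omega)
    obtain rfl : tC = tD := by omega
    omega
  · have := hinj (tC + 1) (tD - 1) (by omega) (by omega) (by omega) (by omega)
    obtain rfl : tD = tC + 2 := by omega
    refine ⟨tC - 1, 1, Or.inl rfl, by omega, ?_⟩
    rw [show tC - 1 + 1 = tC by omega, show tC - 1 + 2 = tC + 1 by omega,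
      show tC - 1 + 3 = tC + 2 by omega, show tC - 1 + 4 = tC + 2 + 1 by omega]
    exact ⟨h1, h2, hxC, hyC, h3, h4, hxD, hyD, g3, g4⟩
  · have := hinj (tC - 1) (tD + 1) (by omega) (by omega) (by omega) (by omega)
    obtain rfl : tC = tD + 2 := by omega
    refine ⟨tD - 1, -1, Or.inr rfl, by omega, ?_⟩
    rw [show tD - 1 + 1 = tD by omega, show tD - 1 + 2 = tD + 1 by omega,
      show tD - 1 + 3 = tD + 2 by omega, show tD - 1 + 4 = tD + 2 + 1 by omega]
    exact ⟨g1, g2, hxD, hyD, g3, g4, hxC, by omega, h3, by omega⟩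
  · have := hinj (tC - 1) (tD - 1) (by omega) (by omega) (by omega) (by omega)
    obtain rfl : tC = tD := by omega
    omega

/-- **No Hamiltonian path of the `3 × 4` box `[-1, 2] × [-1, 1]` from the interior cell `(0, 0)`
to the interior cell `(1, 0)` is cut-free in the long direction**: corner forcing determines the
path (the left column in one go right after the start, then the right column), and the boundary
`x = ½` is then crossed exactly once, at step `5` — an up-cut. [cite: MadrasSlade1993, §7.1] -/
private theorem no_cutFree_hamiltonian_box (x y : ℕ → ℤ)
    (hbx : ∀ i ≤ 11, -1 ≤ x i ∧ x i ≤ 2 ∧ -1 ≤ y i ∧ y i ≤ 1)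
    (hadj : ∀ i < 11, (x (i + 1) = x i + 1 ∧ y (i + 1) = y i) ∨ (x (i + 1) = x i - 1 ∧ y (i + 1) = y i) ∨
      (x (i + 1) = x i ∧ y (i + 1) = y i + 1) ∨ (x (i + 1) = x i ∧ y (i + 1) = y i - 1))
    (hinj : ∀ i j, i ≤ 11 → j ≤ 11 → x i = x j → y i = y j → i = j)
    (hvis : ∀ a b : ℤ, -1 ≤ a → a ≤ 2 → -1 ≤ b → b ≤ 1 → ∃ i ≤ 11, x i = a ∧ y i = b)
    (h0 : x 0 = 0 ∧ y 0 = 0) (h11 : (x 11 = 0 ∨ x 11 = 1) ∧ y 11 = 0)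
    (hncU : ∀ t < 11, x (t + 1) = x t + 1 → (∀ i ≤ t, x i ≤ x t) →
      (∀ i, t + 1 ≤ i → i ≤ 11 → x t + 1 ≤ x i) → False) : False := by
  -- the endpoint is `(1, 0)`
  have hx11 : x 11 = 1 := by
    rcases h11.1 with h | h
    · have := hinj 11 0 le_rfl (by norm_num) (by omega) (by omega); omega
    · exact h
  -- the left column `x = -1`
  obtain ⟨a, s, hs, ha, e0, f0, e1, f1, e2, f2, e3, f3, e4, f4⟩ :=
    column_segment x y hbx hadj hinj hvis (by omega) (by omega)
  -- the right column `x = 2`, by the reflection `x ↦ 1 - x`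
  obtain ⟨b, r, hr, hb, e0', f0', e1', f1', e2', f2', e3', f3', e4', f4'⟩ :=
    column_segment (fun i => 1 - x i) y
      (fun i hi => by have := hbx i hi; omega)
      (fun i hi => by have := hadj i hi; omega)
      (fun i j hi hj h1 h2 => hinj i j hi hj (by omega) h2)
      (fun a' b' h1 h2 h3 h4 => by
        obtain ⟨i, hi, hx, hy⟩ := hvis (1 - a') b' (by omega) (by omega) h3 h4
        exact ⟨i, hi, by omega, hy⟩)
      (by omega) (by omega)
  -- time `1`: the walk leaves `(0, 0)` vertically, into the left segment, so `a = 1`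
  have had0 : (x 1 = x 0 + 1 ∧ y 1 = y 0) ∨ (x 1 = x 0 - 1 ∧ y 1 = y 0) ∨
      (x 1 = x 0 ∧ y 1 = y 0 + 1) ∨ (x 1 = x 0 ∧ y 1 = y 0 - 1) := hadj 0 (by norm_num)
  have hb1 := hbx 1 (by norm_num)
  have ha1 : a = 1 ∧ y 1 = s := by
    rcases had0 with ⟨p, q⟩ | ⟨p, q⟩ | ⟨p, q⟩ | ⟨p, q⟩
    · have := hinj 1 11 (by norm_num) le_rfl (by omega) (by omega); omega
    · have := hinj 1 (a + 2) (by norm_num) (by omega) (by omega) (by omega); omega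
    · rcases hs with rfl | rfl
      · have := hinj 1 a (by norm_num) (by omega) (by omega) (by omega)
        exact ⟨by omega, by omega⟩
      · have := hinj 1 (a + 4) (by norm_num) (by omega) (by omega) (by omega); omega
    · rcases hs with rfl | rfl
      · have := hinj 1 (a + 4) (by norm_num) (by omega) (by omega) (by omega); omega
      · have := hinj 1 a (by norm_num) (by omega) (by omega) (by omega)
        exact ⟨by omega, by omega⟩
  obtain ⟨rfl, hy1⟩ := ha1
  norm_num at e1 f1 e2 f2 e3 f3 e4 f4
  have hx1 : x 1 = 0 := e0
  -- time `6`: from `(0, -s)` the walk must step to `(1, -s)`, into the right segment, so `b = 6`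
  have had5 : (x 6 = x 5 + 1 ∧ y 6 = y 5) ∨ (x 6 = x 5 - 1 ∧ y 6 = y 5) ∨
      (x 6 = x 5 ∧ y 6 = y 5 + 1) ∨ (x 6 = x 5 ∧ y 6 = y 5 - 1) := hadj 5 (by norm_num)
  have hb6 := hbx 6 (by norm_num)
  have h6 : x 6 = 1 ∧ y 6 = -s := by
    rcases had5 with ⟨p, q⟩ | ⟨p, q⟩ | ⟨p, q⟩ | ⟨p, q⟩
    · exact ⟨by omega, by omega⟩
    · have := hinj 6 4 (by norm_num) (by norm_num) (by omega) (by omega); omega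
    · rcases hs with rfl | rfl
      · have := hinj 6 0 (by norm_num) (by norm_num) (by omega) (by omega); omega
      · omega
    · rcases hs with rfl | rfl
      · omega
      · have := hinj 6 0 (by norm_num) (by norm_num) (by omega) (by omega); omega
  have hb6' : b = 6 ∧ r = -s := by
    rcases hr with rfl | rfl <;> rcases hs with rfl | rfl
    · have := hinj 6 (b + 4) (by norm_num) (by omega) (by omega) (by omega)
      obtain rfl : b = 2 := by omega
      norm_num at e2'
      omega
    · have := hinj 6 b (by norm_num) (by omega) (by omega) (by omega)
      exact ⟨by omega, by norm_num⟩
    · have := hinj 6 b (by norm_num) (by omega) (by omega) (by omega)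
      exact ⟨by omega, by norm_num⟩
    · have := hinj 6 (b + 4) (by norm_num) (by omega) (by omega) (by omega)
      obtain rfl : b = 2 := by omega
      norm_num at e2'
      omega
  obtain ⟨rfl, hr'⟩ := hb6'
  norm_num at e1' f1' e2' f2' e3' f3' e4' f4'
  -- the boundary `x = ½` is crossed only at step `5`: an up-cut, contradiction
  refine hncU 5 (by norm_num) (by show x 6 = x 5 + 1; omega) (fun i hi => ?_) (fun i hi hi' => ?_)
  · interval_cases i <;> omega
  · interval_cases i <;> omega

/-! ### From walks on `ℤ²` to coordinates -/

/-- The two indices of `Fin 2`. [folklore] -/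
private theorem fin_two_eq_or {kL kS : Fin 2} (hk : kL ≠ kS) (j : Fin 2) : j = kL ∨ j = kS := by
  fin_cases j <;> fin_cases kL <;> fin_cases kS <;> simp_all

/-- A site of `ℤ²` is determined by its two coordinates. [folklore] -/
private theorem ext_coords {p q : Site 2} {kL kS : Fin 2} (hk : kL ≠ kS) (h1 : p kL = q kL)
    (h2 : p kS = q kS) : p = q := by
  funext j
  rcases fin_two_eq_or hk j with rfl | rfl
  · exact h1
  · exact h2

/-- Adjacency on `ℤ²` in coordinates: one coordinate moves by `±1`, the other stays.
[cite: MadrasSlade1993, §1.1] -/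
private theorem adj_coords {p q : Site 2} (h : (zdGraph 2).Adj p q) {kL kS : Fin 2} (hk : kL ≠ kS) :
    (q kL = p kL + 1 ∧ q kS = p kS) ∨ (q kL = p kL - 1 ∧ q kS = p kS) ∨
      (q kL = p kL ∧ q kS = p kS + 1) ∨ (q kL = p kL ∧ q kS = p kS - 1) := by
  obtain ⟨i, hi | hi⟩ := (zdGraph_adj_iff p q).1 h
  · have hL := congrFun hi kL
    have hS := congrFun hi kS
    rw [Pi.add_apply] at hL hS
    rcases fin_two_eq_or hk i with rfl | rfl
    · rw [Pi.single_eq_same] at hL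
      rw [Pi.single_eq_of_ne hk.symm] at hS
      exact Or.inl ⟨hL, by rw [hS, add_zero]⟩
    · rw [Pi.single_eq_of_ne hk] at hL
      rw [Pi.single_eq_same] at hS
      exact Or.inr (Or.inr (Or.inl ⟨by rw [hL, add_zero], hS⟩))
  · have hL := congrFun hi kL
    have hS := congrFun hi kS
    rw [Pi.add_apply] at hL hS
    rcases fin_two_eq_or hk i with rfl | rfl
    · rw [Pi.single_eq_same] at hL
      rw [Pi.single_eq_of_ne hk.symm] at hS
      exact Or.inr (Or.inl ⟨by rw [hL]; ring, by rw [hS, add_zero]⟩)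
    · rw [Pi.single_eq_of_ne hk] at hL
      rw [Pi.single_eq_same] at hS
      exact Or.inr (Or.inr (Or.inr ⟨by rw [hL, add_zero], by rw [hS]; ring⟩))

/-! ### Surrounded starts, escaping ends -/

/-- A completely surrounded start: every lattice neighbour of the origin is a site of the walk.
[cite: MadrasSlade1993, §1.1] -/
theorem exists_eq_of_extCount_revWalk_eq_zero {d n : ℕ} {ω : ℕ → Site d} (hω : ω ∈ saws d n)
    (hsurr : extCount (revWalk n ω) n = 0) {z : Site d} (hz : (zdGraph d).Adj (ω 0) z) :
    ∃ i ≤ n, ω i = z := by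
  by_contra h
  push Not at h
  have hmem : ω n - z ∈ freeNbrs (revWalk n ω) n :=
    (mem_freeNbrs_revWalk hω).2 ⟨by rw [sub_sub_cancel]; exact hz,
      fun i hi => by rw [sub_sub_cancel]; exact h i hi⟩
  rw [extCount, Finset.card_eq_zero] at hsurr
  rw [hsurr] at hmem
  simp at hmem

/-- **A straight ray escapes from an extreme end.** If the endpoint is extreme in coordinate `k`
(`σ ω j k ≤ σ ω n k` for all sites, `σ = ±1`), the ray `ω n + σ t eₖ`, `t ≥ 1`, is an escape route,
so the end is free. [cite: MadrasSlade1993, §1.1] -/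
theorem endFree_of_extreme {d n : ℕ} {ω : ℕ → Site d} (k : Fin d) {σ : ℤ} (hσ : σ = 1 ∨ σ = -1)
    (h : ∀ j ≤ n, σ * ω j k ≤ σ * ω n k) : EndFree ω n := by
  have hP : ∀ i : ℕ, (fun i : ℕ => ω n + Pi.single k (σ * ((i : ℤ) + 1))) (i + 1) =
      (fun i : ℕ => ω n + Pi.single k (σ * ((i : ℤ) + 1))) i + Pi.single k σ := by
    intro i
    have e : σ * ((i : ℤ) + 1) + σ = σ * (((i + 1 : ℕ) : ℤ) + 1) := by push_cast; ring
    simp only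
    rw [add_assoc, ← Pi.single_add, e]
  have hP0 : (fun i : ℕ => ω n + Pi.single k (σ * ((i : ℤ) + 1))) 0 = ω n + Pi.single k σ := by
    simp
  refine ⟨fun i => ω n + Pi.single k (σ * ((i : ℤ) + 1)), ?_, fun i => ?_, fun i j hij => ?_, ?_⟩
  · rw [zdGraph_adj_iff]
    refine ⟨k, ?_⟩
    rw [hP0]
    rcases hσ with rfl | rfl
    · exact Or.inl rfl
    · right
      rw [add_assoc, ← Pi.single_add]
      simp
  · rw [zdGraph_adj_iff]
    refine ⟨k, ?_⟩
    rw [hP]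
    rcases hσ with rfl | rfl
    · exact Or.inl rfl
    · right
      rw [add_assoc, ← Pi.single_add]
      simp
  · have := congrFun hij k
    simp only [Pi.add_apply, Pi.single_eq_same] at this
    rcases hσ with rfl | rfl
    · exact_mod_cast (by linarith : (i : ℤ) = j)
    · exact_mod_cast (by linarith : (i : ℤ) = j)
  · intro i j hj hEq
    have := congrFun hEq k
    simp only [Pi.add_apply, Pi.single_eq_same] at this
    have hji := h j hj
    rcases hσ with rfl | rfl
    · rw [← this] at hji
      nlinarith
    · rw [← this] at hji
      nlinarith

/-! ### The Hamiltonian box of a cut-free `11`-step walk on `ℤ²` -/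

/-- The two shapes of the box, oriented: with `kL` the long and `kS` the short direction, the
coordinates of a cut-free Hamiltonian path of the box `[mL, mL + 3] × [-1, 1]` (`mL ∈ {-2, -1}`)
from `0` to an interior cell contradict corner forcing. [cite: MadrasSlade1993, §7.1] -/
private theorem no_cutFree_box_walk {ω : ℕ → Site 2} (h0 : ω 0 = 0)
    (hadj : ∀ i < 11, (zdGraph 2).Adj (ω i) (ω (i + 1))) (hinj : Set.InjOn ω {i | i ≤ 11})
    (hcf : CutFree 11 ω) {kL kS : Fin 2} (hk : kL ≠ kS) (mL : ℤ) (hmL : mL = -2 ∨ mL = -1)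
    (hbox : ∀ i ≤ 11, mL ≤ ω i kL ∧ ω i kL ≤ mL + 3 ∧ -1 ≤ ω i kS ∧ ω i kS ≤ 1)
    (hvis : ∀ a b : ℤ, mL ≤ a → a ≤ mL + 3 → -1 ≤ b → b ≤ 1 → ∃ i ≤ 11, ω i kL = a ∧ ω i kS = b)
    (hend : mL < ω 11 kL ∧ ω 11 kL < mL + 3 ∧ ω 11 kS = 0) : False := by
  have hadj' : ∀ i < 11, (ω (i + 1) kL = ω i kL + 1 ∧ ω (i + 1) kS = ω i kS) ∨
      (ω (i + 1) kL = ω i kL - 1 ∧ ω (i + 1) kS = ω i kS) ∨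
      (ω (i + 1) kL = ω i kL ∧ ω (i + 1) kS = ω i kS + 1) ∨
      (ω (i + 1) kL = ω i kL ∧ ω (i + 1) kS = ω i kS - 1) :=
    fun i hi => adj_coords (hadj i hi) hk
  have hinj' : ∀ i j, i ≤ 11 → j ≤ 11 → ω i kL = ω j kL → ω i kS = ω j kS → i = j :=
    fun i j hi hj h1 h2 => hinj (show i ∈ {i | i ≤ 11} from hi) (show j ∈ {i | i ≤ 11} from hj)
      (ext_coords hk h1 h2)
  have hx0 : ω 0 kL = 0 := by rw [h0]; rfl
  have hy0 : ω 0 kS = 0 := by rw [h0]; rfl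
  -- no up-cut and no down-cut in the long direction, in coordinates
  have hncU : ∀ t < 11, ω (t + 1) kL = ω t kL + 1 → (∀ i ≤ t, ω i kL ≤ ω t kL) →
      (∀ i, t + 1 ≤ i → i ≤ 11 → ω t kL + 1 ≤ ω i kL) → False := by
    intro t ht hx hpast hfut
    refine hcf t ⟨kL, Or.inl ⟨ht, ?_, hpast, hfut⟩⟩
    have hy : ω (t + 1) kS = ω t kS := by have := hadj' t ht; omega
    refine ext_coords hk ?_ ?_
    · rw [Pi.add_apply, Pi.single_eq_same, hx]
    · rw [Pi.add_apply, Pi.single_eq_of_ne hk.symm, hy, add_zero]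
  have hncD : ∀ t < 11, ω (t + 1) kL = ω t kL - 1 → (∀ i ≤ t, ω t kL ≤ ω i kL) →
      (∀ i, t + 1 ≤ i → i ≤ 11 → ω i kL ≤ ω t kL - 1) → False := by
    intro t ht hx hpast hfut
    refine hcf t ⟨kL, Or.inr ⟨ht, ?_, fun i hi => ?_, fun i hi hin => ?_⟩⟩
    · have hy : ω (t + 1) kS = ω t kS := by have := hadj' t ht; omega
      refine ext_coords hk ?_ ?_
      · simp only [Pi.neg_apply, Pi.add_apply, Pi.single_eq_same]; omega
      · simp only [Pi.neg_apply, Pi.add_apply, Pi.single_eq_of_ne hk.symm]; omega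
    · simp only [Pi.neg_apply]
      have := hpast i hi; omega
    · simp only [Pi.neg_apply]
      have := hfut i hi hin; omega
  rcases hmL with rfl | rfl
  · -- box `[-2, 1] × [-1, 1]`: apply the core to the mirror image `-ω`
    refine no_cutFree_hamiltonian_box (fun i => -ω i kL) (fun i => -ω i kS)
      (fun i hi => by have := hbox i hi; omega) (fun i hi => by have := hadj' i hi; omega)
      (fun i j hi hj h1 h2 => hinj' i j hi hj (by omega) (by omega))
      (fun a b h1 h2 h3 h4 => ?_) ⟨by omega, by omega⟩ ⟨by omega, by omega⟩
      (fun t ht h1 h2 h3 => hncD t ht (by omega) (fun i hi => by have := h2 i hi; omega)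
        (fun i hi hi' => by have := h3 i hi hi'; omega))
    obtain ⟨i, hi, hx, hy⟩ := hvis (-a) (-b) (by omega) (by omega) (by omega) (by omega)
    exact ⟨i, hi, by omega, by omega⟩
  · -- box `[-1, 2] × [-1, 1]`
    exact no_cutFree_hamiltonian_box (fun i => ω i kL) (fun i => ω i kS)
      (fun i hi => by have := hbox i hi; omega) hadj' hinj'
      (fun a b h1 h2 h3 h4 => hvis a b (by omega) (by omega) h3 h4)
      ⟨hx0, hy0⟩ ⟨by omega, by omega⟩ hncU

open Classical in
/-- **On `ℤ²` no cut-free `11`-step self-avoiding walk has a completely surrounded start and a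
doomed end**: `escapeResidual 2 11 ∩ cutFree 2 11 = ∅` (stated for `n = 11` symbolically).  A
cut-free `11`-step walk is a Hamiltonian path of a `3 × 4` box (crossing bound and box bound of
`SAWCountMonotoneCutFreeBox.lean`); a surrounded start is an interior cell; an end on the boundary
of the box escapes along a straight ray, so a doomed end is interior too; and corner forcing leaves
no cut-free Hamiltonian path between the two interior cells.
[cite: MadrasSlade1993, §7.1] [cite: BDGS2012, §1.3 (`cₙ ≤ cₙ₊₁`, O'Brien 1990)] -/
theorem escapeResidual_inter_cutFree_two_eq_empty {n : ℕ} (hn : n = 11) :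
    escapeResidual 2 n ∩ cutFree 2 n = ∅ := by
  classical
  rw [Finset.eq_empty_iff_forall_notMem]
  intro ω hω
  obtain ⟨hR, hC⟩ := Finset.mem_inter.1 hω
  obtain ⟨hω, hdoom, hsurr⟩ := mem_escapeResidual.1 hR
  obtain ⟨-, hcf⟩ := mem_cutFree.1 hC
  obtain ⟨h0, -, hadj, hinj⟩ := mem_saws.1 hω
  -- the bounding box `[m k, M k]`
  have hne : (Finset.range (n + 1)).Nonempty := ⟨0, by simp⟩
  have hmin : ∀ k : Fin 2, ∃ i ∈ Finset.range (n + 1), ∀ j ∈ Finset.range (n + 1), ω i k ≤ ω j k :=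
    fun k => Finset.exists_min_image _ (fun i => ω i k) hne
  have hmax : ∀ k : Fin 2, ∃ i ∈ Finset.range (n + 1), ∀ j ∈ Finset.range (n + 1), ω j k ≤ ω i k :=
    fun k => Finset.exists_max_image _ (fun i => ω i k) hne
  choose im him hle using hmin
  choose iM hiM hge using hmax
  set m : Fin 2 → ℤ := fun k => ω (im k) k with hm
  set M : Fin 2 → ℤ := fun k => ω (iM k) k with hM
  have hbox : ∀ i ≤ n, ∀ k, m k ≤ ω i k ∧ ω i k ≤ M k := fun i hi k =>
    ⟨hle k i (Finset.mem_range.2 (by omega)), hge k i (Finset.mem_range.2 (by omega))⟩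
  have h1 := hcf.two_mul_sum_extent_add_one_le hω (by omega) m M
    (fun k => ⟨im k, by have := Finset.mem_range.1 (him k); omega, rfl⟩)
    (fun k => ⟨iM k, by have := Finset.mem_range.1 (hiM k); omega, rfl⟩) hbox
  have h2 := succ_le_prod_extent hω m M hbox
  rw [Fin.sum_univ_two] at h1
  rw [Fin.prod_univ_two] at h2
  have hW0 : 0 ≤ M 0 - m 0 := by have := hbox 0 (by omega) 0; omega
  have hH0 : 0 ≤ M 1 - m 1 := by have := hbox 0 (by omega) 1; omega
  obtain ⟨W, hW⟩ : ∃ W : ℕ, (W : ℤ) = M 0 - m 0 := ⟨(M 0 - m 0).toNat, Int.toNat_of_nonneg hW0⟩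
  obtain ⟨H, hH⟩ : ∃ H : ℕ, (H : ℤ) = M 1 - m 1 := ⟨(M 1 - m 1).toNat, Int.toNat_of_nonneg hH0⟩
  rw [← hW, ← hH] at h1
  rw [← hW, ← hH, show ((W : ℤ) + 1).toNat = W + 1 by simp,
    show ((H : ℤ) + 1).toNat = H + 1 by simp] at h2
  have hWH : (W = 3 ∧ H = 2) ∨ (W = 2 ∧ H = 3) := by
    have hW5 : W ≤ 5 := by omega
    have hH5 : H ≤ 5 := by omega
    interval_cases W <;> interval_cases H <;> omega
  -- every cell of the box is visited (the `12` sites fill the `12` cells)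
  have hfill : ∀ p : Site 2, (∀ k, m k ≤ p k ∧ p k ≤ M k) → ∃ i ≤ n, ω i = p := by
    intro p hp
    set S := (Finset.range (n + 1)).image ω with hS
    set B := Fintype.piFinset fun k => Finset.Icc (m k) (M k) with hB
    have hSB : S ⊆ B := by
      intro q hq
      obtain ⟨i, hi, rfl⟩ := Finset.mem_image.1 hq
      rw [hB, Fintype.mem_piFinset]
      intro k
      rw [Finset.mem_Icc]
      exact hbox i (by have := Finset.mem_range.1 hi; omega) k
    have hScard : S.card = n + 1 := by
      rw [hS, Finset.card_image_of_injOn, Finset.card_range]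
      intro i hi j hj h
      exact hinj (show i ∈ {i | i ≤ n} by have := Finset.mem_range.1 (Finset.mem_coe.1 hi); simp; omega)
        (show j ∈ {i | i ≤ n} by have := Finset.mem_range.1 (Finset.mem_coe.1 hj); simp; omega) h
    have hBcard : B.card ≤ 12 := by
      rw [hB, Fintype.card_piFinset, Fin.prod_univ_two, Int.card_Icc, Int.card_Icc]
      have e1 : (M 0 + 1 - m 0).toNat = W + 1 := by omega
      have e2 : (M 1 + 1 - m 1).toNat = H + 1 := by omega
      rw [e1, e2]
      rcases hWH with ⟨rfl, rfl⟩ | ⟨rfl, rfl⟩ <;> norm_num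
    have hSeqB : S = B := Finset.eq_of_subset_of_card_le hSB (by omega)
    have hp' : p ∈ B := by
      rw [hB, Fintype.mem_piFinset]
      intro k
      rw [Finset.mem_Icc]
      exact hp k
    rw [← hSeqB, hS, Finset.mem_image] at hp'
    obtain ⟨i, hi, he⟩ := hp'
    exact ⟨i, by have := Finset.mem_range.1 hi; omega, he⟩
  -- the start is surrounded: `±e_k` are sites, so `m k ≤ -1` and `1 ≤ M k`
  have hstart : ∀ k, m k ≤ -1 ∧ 1 ≤ M k := by
    intro k
    obtain ⟨i, hi, he⟩ := exists_eq_of_extCount_revWalk_eq_zero hω hsurr (z := Pi.single k 1)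
      ((zdGraph_adj_iff _ _).2 ⟨k, Or.inl (by rw [h0, zero_add])⟩)
    obtain ⟨j, hj, he'⟩ := exists_eq_of_extCount_revWalk_eq_zero hω hsurr (z := -Pi.single k 1)
      ((zdGraph_adj_iff _ _).2 ⟨k, Or.inr (by rw [h0, neg_add_cancel])⟩)
    have h1 := (hbox i hi k).2
    have h2 := (hbox j hj k).1
    rw [he, Pi.single_eq_same] at h1
    rw [he', Pi.neg_apply, Pi.single_eq_same] at h2
    exact ⟨h2, h1⟩
  -- the end is interior: otherwise a straight ray escapes
  have hendk : ∀ k, m k < ω n k ∧ ω n k < M k := by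
    intro k
    constructor
    · by_contra hle
      refine hdoom (endFree_of_extreme k (σ := -1) (Or.inr rfl) fun j hj => ?_)
      have := (hbox j hj k).1
      have := (hbox n le_rfl k).1
      omega
    · by_contra hle
      refine hdoom (endFree_of_extreme k (σ := 1) (Or.inl rfl) fun j hj => ?_)
      have := (hbox j hj k).2
      have := (hbox n le_rfl k).2
      omega
  -- from here on `n = 11` numerically; forget the walk hypotheses that mention `saws`
  clear hR hC hω
  subst hn
  -- orient the box and apply the core
  rcases hWH with ⟨rfl, rfl⟩ | ⟨rfl, rfl⟩
  · -- long direction `0`, short direction `1`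
    have hs0 := hstart 0; have hs1 := hstart 1; have he0 := hendk 0; have he1 := hendk 1
    refine no_cutFree_box_walk h0 hadj hinj hcf (kL := 0) (kS := 1) (by decide) (m 0) (by omega)
      (fun i hi => ?_) (fun a b h1 h2 h3 h4 => ?_) ⟨by omega, by omega, by omega⟩
    · have := hbox i hi 0; have := hbox i hi 1; omega
    · obtain ⟨i, hi, he⟩ := hfill ![a, b] fun k => by
        fin_cases k <;> simp <;> omega
      exact ⟨i, hi, by rw [he]; simp, by rw [he]; simp⟩
  · -- long direction `1`, short direction `0`
    have hs0 := hstart 0; have hs1 := hstart 1; have he0 := hendk 0; have he1 := hendk 1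
    refine no_cutFree_box_walk h0 hadj hinj hcf (kL := 1) (kS := 0) (by decide) (m 1) (by omega)
      (fun i hi => ?_) (fun a b h1 h2 h3 h4 => ?_) ⟨by omega, by omega, by omega⟩
    · have := hbox i hi 0; have := hbox i hi 1; omega
    · obtain ⟨i, hi, he⟩ := hfill ![b, a] fun k => by
        fin_cases k <;> simp <;> omega
      exact ⟨i, hi, by rw [he]; simp, by rw [he]; simp⟩

/-- **`c₁₁ ≤ c₁₂` on `ℤ²`** (O'Brien's inequality on the square lattice at `n = 11 = 6d - 1`, the
first odd length where the escape residual is non-empty), by cut-edge doubling combined with the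
escape injection. [cite: BDGS2012, §1.3 (`cₙ ≤ cₙ₊₁`, O'Brien 1990)] -/
theorem count_two_eleven_le : count 2 11 ≤ count 2 12 :=
  count_le_count_succ_of_escapeResidual_inter_cutFree_eq_empty
    (escapeResidual_inter_cutFree_two_eq_empty rfl)

/-- **O'Brien's inequality `cₙ ≤ cₙ₊₁` on `ℤ²` for every `n ≤ 12`.** Lengths `1 ≤ n ≤ 10` and
`n = 12`: no cut-free walks (`count_two_le_count_succ_of_cutFree`); `n = 11`:
`count_two_eleven_le`; `n = 0`: `c₀ = 1 ≤ c₁`. [cite: BDGS2012, §1.3 (`cₙ ≤ cₙ₊₁`, O'Brien 1990)] -/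
theorem count_two_le_count_succ_of_le_twelve {n : ℕ} (hn : n ≤ 12) : count 2 n ≤ count 2 (n + 1) := by
  rcases Nat.eq_zero_or_pos n with rfl | hpos
  · rw [count_zero]; exact one_le_count 2 1
  by_cases h11 : n = 11
  · subst h11; exact count_two_eleven_le
  exact count_two_le_count_succ_of_cutFree (by omega)

end Literature.Probability.RandomPlanarGeometry.SAW.Zd

end
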